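import Mathlib

/-!
# The `L²[0,1]` lower bound for monic polynomials with a prescribed zero at the origin
# (Müntz–Legendre distance formula, special case; Borwein–Erdélyi §4.2 E.2(c), §1.2 E.7(b))

For integers `0 ≤ p ≤ n` and a real MONIC polynomial `P` of degree `n` whose coefficients of `X^j`, `j < p`, all vanish
(i.e. `P(u) = uᵖ · (u^{n-p} + d_{n-p-1} u^{n-p-1} + ⋯ + d₀)`), we prove

  `∫₀¹ P(u)² du ≥ (1/(2n+1)) · ∏_{i=p}^{n-1} ((n − i)/(n + i + 1))²`
  `            = 1 / ((2n+1) · binom(2n, n+p)²)`.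

This is the square of the `L²[0,1]` distance from `xⁿ` to `span{xᵖ, …, x^{n-1}}` given by the Müntz–Legendre / Gram
determinant formula [cite: BorweinErdelyi1995, §4.2 E.2(c)] (`d = (2γ+1)^{-1/2} ∏ |γ − λᵢ|/(γ + λᵢ + 1)` with `γ = n`,
`λᵢ = p, …, n − 1`), and it is the inequality used in the last step of [cite: BorweinErdelyi1995, §1.2 E.7(b)]
(Schur / Erdős–Turán bound on the number of positive zeros; see `ErdosTuranPositiveZerosHolds.lean`).

Proof (a shorter road than the Gram/Cauchy-determinant computation of the book, same extremal function): let
`N(t) = ∏_{i=p}^{n-1} (t − i)` and take the Lagrange (barycentric) expansion of `N` at the `n − p + 1` nodes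
`t = −(j+1)`, `j = p, …, n` (Mathlib: `Lagrange.eq_interpolate`, `Lagrange.eval_interpolate_not_at_node`):
`N(t)/∏_{j=p}^{n}(t + j + 1) = Σ_{j=p}^{n} B_j/(t + j + 1)`.  Hence the polynomial `g(u) = Σ_j B_j uʲ` satisfies
`∫₀¹ uⁱ g(u) du = Σ_j B_j/(i+j+1) = 0` for `p ≤ i < n` (a zero of `N`), and `∫₀¹ uⁿ g = γ := N(n)/∏_j (n+j+1)`.
So `∫₀¹ P g = γ`, `∫₀¹ g² = B_n γ`, and `0 ≤ ∫₀¹ (P − g/B_n)² = ∫₀¹ P² − γ/B_n`, where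
`γ/B_n = (2n+1)^{-1} ∏_{i=p}^{n-1} ((n−i)/(n+i+1))²`.  Finally `∏_{i=p}^{n-1} (n+i+1)/(n−i) = binom(2n, n+p)`.

Mathlib only; no named facts; everything here is proved.
-/

noncomputable section

open Polynomial Finset intervalIntegral

namespace Literature.Algebra.Polynomial

namespace MonicSpanL2

/-- Partial fractions (barycentric Lagrange form of `N(t) = ∏_{i∈[p,n)} (t − i)` at the nodes `−(j+1)`,
`j ∈ [p,n]`): with `B_j = w_j · N(−(j+1))`, `Σ_{j=p}^{n} B_j/(x + j + 1) = N(x)/∏_{j=p}^{n} (x + j + 1)` for `x ≥ 0`.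
[folklore] -/
private lemma sum_nodalWeight_mul_div (n p : ℕ) (hp : p ≤ n) (x : ℝ) (hx : 0 ≤ x) :
    ∑ j ∈ Icc p n, (Lagrange.nodalWeight (Icc p n) (fun j : ℕ => -((j : ℝ) + 1)) j *
        (Lagrange.nodal (Ico p n) (fun i : ℕ => (i : ℝ))).eval (-((j : ℝ) + 1))) / (x + j + 1)
      = (Lagrange.nodal (Ico p n) (fun i : ℕ => (i : ℝ))).eval x / ∏ j ∈ Icc p n, (x + j + 1) := by
  classical
  set v : ℕ → ℝ := fun j : ℕ => -((j : ℝ) + 1) with hv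
  set N : ℝ[X] := Lagrange.nodal (Ico p n) (fun i : ℕ => (i : ℝ)) with hN
  have hvs : Set.InjOn v (↑(Icc p n) : Set ℕ) := by
    intro a _ b _ h
    simp only [hv, neg_inj, add_left_inj, Nat.cast_inj] at h
    exact h
  have hdeg : N.degree < #(Icc p n) := by
    rw [hN, Lagrange.degree_nodal, Nat.card_Ico, Nat.card_Icc]
    exact_mod_cast (by omega : n - p < n + 1 - p)
  have hvj : ∀ j : ℕ, v j = -((j : ℝ) + 1) := fun j => rfl
  have hnode : ∀ j ∈ Icc p n, x ≠ v j := by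
    intro j _ h
    rw [hvj] at h
    have : (0 : ℝ) ≤ (j : ℝ) := Nat.cast_nonneg j
    linarith
  have hinterp := Lagrange.eq_interpolate (f := N) hvs hdeg
  have heval := Lagrange.eval_interpolate_not_at_node (s := Icc p n) (v := v) (fun i => N.eval (v i)) hnode
  rw [← hinterp, Lagrange.eval_nodal (s := Icc p n) (v := v)] at heval
  simp only [hvj] at heval
  have hsub : ∀ j : ℕ, x - -((j : ℝ) + 1) = x + j + 1 := by intro j; ring
  simp only [hsub] at heval
  have hD : (∏ j ∈ Icc p n, (x + j + 1)) ≠ 0 := by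
    refine Finset.prod_ne_zero_iff.2 fun j _ => ?_
    have : (0 : ℝ) ≤ (j : ℝ) := Nat.cast_nonneg j
    linarith
  have hsum : ∑ j ∈ Icc p n, (Lagrange.nodalWeight (Icc p n) v j * N.eval (-((j : ℝ) + 1))) / (x + j + 1)
      = ∑ j ∈ Icc p n, Lagrange.nodalWeight (Icc p n) v j * (x + j + 1)⁻¹ * N.eval (-((j : ℝ) + 1)) :=
    Finset.sum_congr rfl fun j _ => by rw [div_eq_mul_inv]; ring
  rw [hsum, eq_div_iff hD, heval]
  ring

/-- **The dual coefficients.**  There are reals `B_p, …, B_n` with `Σ_j B_j/(i+j+1) = 0` for `p ≤ i < n`,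
`Σ_j B_j/(n+j+1) = ∏_{i∈[p,n)} (n−i) / ∏_{j∈[p,n]} (n+j+1)` and `B_n = ∏_{i∈[p,n)} (n+i+1)/(n−i)`
(the partial-fraction coefficients of `∏_{i∈[p,n)} (t−i)/∏_{j∈[p,n]} (t+j+1)`). [folklore] -/
private theorem exists_dual_coeffs (n p : ℕ) (hp : p ≤ n) :
    ∃ B : ℕ → ℝ,
      (∀ i ∈ Ico p n, ∑ j ∈ Icc p n, B j / ((i : ℝ) + j + 1) = 0) ∧
      (∑ j ∈ Icc p n, B j / ((n : ℝ) + j + 1)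
          = (∏ i ∈ Ico p n, ((n : ℝ) - i)) / ∏ j ∈ Icc p n, ((n : ℝ) + j + 1)) ∧
      B n = ∏ i ∈ Ico p n, ((n : ℝ) + i + 1) / ((n : ℝ) - i) := by
  classical
  refine ⟨fun j => Lagrange.nodalWeight (Icc p n) (fun j : ℕ => -((j : ℝ) + 1)) j *
      (Lagrange.nodal (Ico p n) (fun i : ℕ => (i : ℝ))).eval (-((j : ℝ) + 1)), ?_, ?_, ?_⟩
  · intro i hi
    rw [sum_nodalWeight_mul_div n p hp (i : ℝ) (Nat.cast_nonneg i), Lagrange.eval_nodal_at_node hi, zero_div]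
  · rw [sum_nodalWeight_mul_div n p hp (n : ℝ) (Nat.cast_nonneg n), Lagrange.eval_nodal]
  · dsimp only
    rw [Lagrange.nodalWeight, Finset.Icc_erase_right, Lagrange.eval_nodal, ← Finset.prod_mul_distrib]
    refine Finset.prod_congr rfl fun i hi => ?_
    have hin : i < n := (Finset.mem_Ico.1 hi).2
    have hne : (n : ℝ) - i ≠ 0 := by
      have : (i : ℝ) < n := by exact_mod_cast hin
      linarith
    have hne' : -((n : ℝ) + 1) - (-((i : ℝ) + 1)) ≠ 0 := by
      intro h; apply hne; linarith
    rw [inv_mul_eq_div, div_eq_div_iff hne' hne]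
    ring

/-- `∫₀¹ Σ_k a_k u^{e_k} du = Σ_k a_k/(e_k + 1)`. [folklore] -/
private lemma integral_sum_mul_pow {ι : Type*} (s : Finset ι) (a : ι → ℝ) (e : ι → ℕ) :
    ∫ u in (0 : ℝ)..1, ∑ k ∈ s, a k * u ^ (e k) = ∑ k ∈ s, a k / ((e k : ℝ) + 1) := by
  rw [intervalIntegral.integral_finsetSum]
  · refine Finset.sum_congr rfl fun k _ => ?_
    rw [intervalIntegral.integral_const_mul, integral_pow, one_pow, zero_pow (Nat.succ_ne_zero _), sub_zero]
    ring
  · intro k _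
    exact ((continuous_const.mul (continuous_pow (e k))).intervalIntegrable _ _)

/-- `∫₀¹ P(u) · (Σ_j B_j uʲ) du = Σ_j B_j/(n+j+1)` for `P` monic of degree `n` with vanishing coefficients below `p`,
when `Σ_j B_j/(i+j+1) = 0` for `p ≤ i < n`. [folklore] -/
private lemma integral_eval_mul_dual (n p : ℕ) (P : ℝ[X]) (hmon : P.Monic) (hdeg : P.natDegree = n)
    (hlow : ∀ j < p, P.coeff j = 0) (B : ℕ → ℝ)
    (hB : ∀ i ∈ Ico p n, ∑ j ∈ Icc p n, B j / ((i : ℝ) + j + 1) = 0) :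
    ∫ u in (0 : ℝ)..1, P.eval u * ∑ j ∈ Icc p n, B j * u ^ j = ∑ j ∈ Icc p n, B j / ((n : ℝ) + j + 1) := by
  have hexp : ∀ u : ℝ, P.eval u * ∑ j ∈ Icc p n, B j * u ^ j =
      ∑ x ∈ range (n + 1) ×ˢ Icc p n, (P.coeff x.1 * B x.2) * u ^ (x.1 + x.2) := by
    intro u
    rw [Polynomial.eval_eq_sum_range, hdeg, Finset.sum_mul_sum, Finset.sum_product]
    refine Finset.sum_congr rfl fun i _ => Finset.sum_congr rfl fun j _ => ?_
    ring
  simp_rw [hexp]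
  rw [integral_sum_mul_pow, Finset.sum_product]
  have hinner : ∀ i ∈ range (n + 1),
      ∑ j ∈ Icc p n, P.coeff i * B j / (((i + j : ℕ) : ℝ) + 1) =
        P.coeff i * ∑ j ∈ Icc p n, B j / ((i : ℝ) + j + 1) := by
    intro i _
    rw [Finset.mul_sum]
    refine Finset.sum_congr rfl fun j _ => ?_
    push_cast
    ring
  rw [Finset.sum_congr rfl hinner, Finset.sum_range_succ]
  have hlc : P.coeff n = 1 := by rw [← hdeg]; exact hmon.coeff_natDegree
  rw [hlc, one_mul]
  have hzero : ∑ i ∈ range n, P.coeff i * ∑ j ∈ Icc p n, B j / ((i : ℝ) + j + 1) = 0 := by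
    refine Finset.sum_eq_zero fun i hi => ?_
    have hin : i < n := Finset.mem_range.1 hi
    by_cases hip : i < p
    · rw [hlow i hip, zero_mul]
    · rw [hB i (Finset.mem_Ico.2 ⟨not_lt.1 hip, hin⟩), mul_zero]
  rw [hzero, zero_add]

/-- `∫₀¹ (Σ_j B_j uʲ)² du = B_n · Σ_j B_j/(n+j+1)` under the same orthogonality. [folklore] -/
private lemma integral_dual_sq (n p : ℕ) (hp : p ≤ n) (B : ℕ → ℝ)
    (hB : ∀ i ∈ Ico p n, ∑ j ∈ Icc p n, B j / ((i : ℝ) + j + 1) = 0) :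
    ∫ u in (0 : ℝ)..1, (∑ j ∈ Icc p n, B j * u ^ j) * ∑ j ∈ Icc p n, B j * u ^ j
      = B n * ∑ j ∈ Icc p n, B j / ((n : ℝ) + j + 1) := by
  have hexp : ∀ u : ℝ, (∑ j ∈ Icc p n, B j * u ^ j) * ∑ j ∈ Icc p n, B j * u ^ j =
      ∑ x ∈ Icc p n ×ˢ Icc p n, (B x.1 * B x.2) * u ^ (x.1 + x.2) := by
    intro u
    rw [Finset.sum_mul_sum, Finset.sum_product]
    refine Finset.sum_congr rfl fun i _ => Finset.sum_congr rfl fun j _ => ?_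
    ring
  simp_rw [hexp]
  rw [integral_sum_mul_pow, Finset.sum_product]
  have hinner : ∀ i ∈ Icc p n,
      ∑ j ∈ Icc p n, B i * B j / (((i + j : ℕ) : ℝ) + 1) = B i * ∑ j ∈ Icc p n, B j / ((i : ℝ) + j + 1) := by
    intro i _
    rw [Finset.mul_sum]
    refine Finset.sum_congr rfl fun j _ => ?_
    push_cast
    ring
  rw [Finset.sum_congr rfl hinner,
    Finset.sum_eq_single_of_mem n (Finset.mem_Icc.2 ⟨hp, le_rfl⟩) (fun i hi hne => ?_)]
  have hi' : i ∈ Ico p n :=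
    Finset.mem_Ico.2 ⟨(Finset.mem_Icc.1 hi).1, lt_of_le_of_ne (Finset.mem_Icc.1 hi).2 hne⟩
  rw [hB i hi', mul_zero]

/-- The value of the constant: `γ/B_n = (2n+1)^{-1} ∏_{i=p}^{n-1} ((n−i)/(n+i+1))²`. [folklore] -/
private lemma dual_ratio (n p : ℕ) (hp : p ≤ n) :
    ((∏ i ∈ Ico p n, ((n : ℝ) - i)) / ∏ j ∈ Icc p n, ((n : ℝ) + j + 1))
        / (∏ i ∈ Ico p n, ((n : ℝ) + i + 1) / ((n : ℝ) - i))
      = (∏ i ∈ Ico p n, (((n : ℝ) - i) / ((n : ℝ) + i + 1))) ^ 2 / (2 * n + 1) := by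
  have hpos : ∀ i ∈ Ico p n, (0 : ℝ) < (n : ℝ) + i + 1 := by
    intro i _; have : (0 : ℝ) ≤ (i : ℝ) := Nat.cast_nonneg i; linarith
  have hpos' : ∀ i ∈ Ico p n, (0 : ℝ) < (n : ℝ) - i := by
    intro i hi
    have : (i : ℝ) < n := by exact_mod_cast (Finset.mem_Ico.1 hi).2
    linarith
  have hD : (∏ i ∈ Ico p n, ((n : ℝ) + i + 1)) ≠ 0 :=
    Finset.prod_ne_zero_iff.2 fun i hi => (hpos i hi).ne'
  have hNm : (∏ i ∈ Ico p n, ((n : ℝ) - i)) ≠ 0 :=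
    Finset.prod_ne_zero_iff.2 fun i hi => (hpos' i hi).ne'
  have h2n : (2 * (n : ℝ) + 1) ≠ 0 := by positivity
  rw [← Finset.Ico_insert_right hp, Finset.prod_insert Finset.right_notMem_Ico,
    Finset.prod_div_distrib, Finset.prod_div_distrib, div_pow]
  field_simp
  ring

/-- **The `L²[0,1]` lower bound** (Müntz–Legendre distance from `xⁿ` to `span{xᵖ,…,x^{n-1}}`, product form):
for a real monic `P` of degree `n` with `coeff P j = 0` for all `j < p` (`p ≤ n`),
`(2n+1)^{-1} · ∏_{i=p}^{n-1} ((n−i)/(n+i+1))² ≤ ∫₀¹ P(u)² du`.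
(With `γ = n`, `λᵢ = p, …, n−1`; used in §1.2 E.7(b).) [cite: BorweinErdelyi1995, §4.2 E.2(c)] -/
theorem integral_sq_ge_prod (n p : ℕ) (hp : p ≤ n) (P : ℝ[X]) (hmon : P.Monic) (hdeg : P.natDegree = n)
    (hlow : ∀ j < p, P.coeff j = 0) :
    (∏ i ∈ Ico p n, (((n : ℝ) - i) / ((n : ℝ) + i + 1))) ^ 2 / (2 * n + 1)
      ≤ ∫ u in (0 : ℝ)..1, (P.eval u) ^ 2 := by
  obtain ⟨B, hB0, hBtop, hBn⟩ := exists_dual_coeffs n p hp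
  have hI2' := integral_eval_mul_dual n p P hmon hdeg hlow B hB0
  have hI3' := integral_dual_sq n p hp B hB0
  rw [← dual_ratio n p hp]
  -- name the dual function and the two constants (opaque names, defining equations kept)
  obtain ⟨g, hg⟩ : ∃ g : ℝ → ℝ, (fun u => ∑ j ∈ Icc p n, B j * u ^ j) = g := ⟨_, rfl⟩
  obtain ⟨γ, hγ⟩ : ∃ γ : ℝ, (∏ i ∈ Ico p n, ((n : ℝ) - i)) / ∏ j ∈ Icc p n, ((n : ℝ) + j + 1) = γ := ⟨_, rfl⟩
  obtain ⟨β, hβ⟩ : ∃ β : ℝ, ∏ i ∈ Ico p n, ((n : ℝ) + i + 1) / ((n : ℝ) - i) = β := ⟨_, rfl⟩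
  rw [hγ, hβ]
  rw [hγ] at hBtop
  rw [hβ] at hBn
  rw [hBtop] at hI2' hI3'
  rw [hBn] at hI3'
  have hI2 : ∫ u in (0 : ℝ)..1, P.eval u * g u = γ := by simpa only [← hg] using hI2'
  have hI3 : ∫ u in (0 : ℝ)..1, g u * g u = β * γ := by simpa only [← hg] using hI3'
  have hβpos : 0 < β := by
    rw [← hβ]
    refine Finset.prod_pos fun i hi => ?_
    have hin : i < n := (Finset.mem_Ico.1 hi).2
    have : (i : ℝ) < n := by exact_mod_cast hin
    have : (0 : ℝ) ≤ (i : ℝ) := Nat.cast_nonneg i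
    exact div_pos (by linarith) (by linarith)
  obtain ⟨c, hc⟩ : ∃ c : ℝ, β⁻¹ = c := ⟨_, rfl⟩
  have hPc : Continuous fun u : ℝ => P.eval u := P.continuous
  have hgc : Continuous g := by
    rw [← hg]
    exact continuous_finsetSum _ fun j _ => continuous_const.mul (continuous_pow j)
  have hi1 : IntervalIntegrable (fun u => (P.eval u) ^ 2) MeasureTheory.volume 0 1 :=
    (hPc.pow 2).intervalIntegrable _ _
  have hi2 : IntervalIntegrable (fun u => P.eval u * g u) MeasureTheory.volume 0 1 :=
    (hPc.mul hgc).intervalIntegrable _ _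
  have hi3 : IntervalIntegrable (fun u => g u * g u) MeasureTheory.volume 0 1 :=
    (hgc.mul hgc).intervalIntegrable _ _
  -- `0 ≤ ∫ (P − c g)² = ∫ P² − 2c ∫ P g + c² ∫ g²`
  have hnonneg : 0 ≤ ∫ u in (0 : ℝ)..1, (P.eval u - c * g u) ^ 2 :=
    intervalIntegral.integral_nonneg zero_le_one fun u _ => sq_nonneg _
  have hsplit : ∫ u in (0 : ℝ)..1, (P.eval u - c * g u) ^ 2 =
      (∫ u in (0 : ℝ)..1, (P.eval u) ^ 2) - 2 * c * (∫ u in (0 : ℝ)..1, P.eval u * g u)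
        + c ^ 2 * (∫ u in (0 : ℝ)..1, g u * g u) := by
    have hpt : ∀ u : ℝ, (P.eval u - c * g u) ^ 2 =
        ((P.eval u) ^ 2 - 2 * c * (P.eval u * g u)) + c ^ 2 * (g u * g u) := by
      intro u; ring
    simp_rw [hpt]
    rw [intervalIntegral.integral_add, intervalIntegral.integral_sub, intervalIntegral.integral_const_mul,
      intervalIntegral.integral_const_mul]
    · exact hi1
    · exact hi2.const_mul _
    · exact hi1.sub (hi2.const_mul _)
    · exact hi3.const_mul _
  rw [hsplit, hI2, hI3] at hnonneg
  have hkey : 2 * c * γ - c ^ 2 * (β * γ) = γ / β := by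
    rw [← hc]; field_simp; ring
  linarith

/-! ## The product is a binomial coefficient -/

/-- `∏_{i=p}^{n-1} (n + i + 1) · (n−p)! … ` in the form: `∏_{i ∈ [p,n)} (n+i+1) = binom(2n, n−p) · (n−p)!` and
`∏_{i ∈ [p,n)} (n − i) = (n − p)!`, whence `∏ (n+i+1)/(n−i) = binom(2n, n−p) = binom(2n, n+p)`. [folklore] -/
private lemma prod_Ico_sub_eq_factorial (n p : ℕ) (hp : p ≤ n) :
    ∏ i ∈ Ico p n, ((n : ℝ) - i) = ((n - p).factorial : ℝ) := by
  rw [Finset.prod_Ico_eq_prod_range]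
  have h : ∀ k ∈ range (n - p), ((n : ℝ) - ((p + k : ℕ) : ℝ)) = (((n - p - k : ℕ) : ℝ)) := by
    intro k hk
    have hk' : k < n - p := Finset.mem_range.1 hk
    push_cast [Nat.sub_sub, Nat.cast_sub (show p + k ≤ n by omega)]
    ring
  rw [Finset.prod_congr rfl h, ← Nat.cast_prod, ← Nat.descFactorial_eq_prod_range, Nat.descFactorial_self]

/-- `∏_{i ∈ [p,n)} (n+i+1) = binom(2n, n−p) · (n−p)!`. [folklore] -/
private lemma prod_Ico_add_eq (n p : ℕ) (hp : p ≤ n) :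
    ∏ i ∈ Ico p n, ((n : ℝ) + i + 1) = ((Nat.choose (2 * n) (n - p) * (n - p).factorial : ℕ) : ℝ) := by
  rw [Finset.prod_Ico_eq_prod_range, ← Finset.prod_range_reflect]
  have h : ∀ k ∈ range (n - p), ((n : ℝ) + ((p + (n - p - 1 - k) : ℕ) : ℝ) + 1) = (((2 * n - k : ℕ) : ℝ)) := by
    intro k hk
    have hk' : k < n - p := Finset.mem_range.1 hk
    push_cast [Nat.cast_sub (show k ≤ 2 * n by omega), Nat.cast_sub (show k ≤ n - p - 1 by omega),
      Nat.cast_sub (show 1 ≤ n - p by omega), Nat.cast_sub hp]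
    ring
  rw [Finset.prod_congr rfl h, ← Nat.cast_prod, ← Nat.descFactorial_eq_prod_range,
    Nat.descFactorial_eq_factorial_mul_choose, mul_comm]

/-- `∏_{i=p}^{n-1} (n − i)/(n + i + 1) = 1/binom(2n, n+p)` — the identification of the Müntz product with the
binomial coefficient in `4ⁿ/(√(2n+1)·binom(2n,n+m))`. [cite: BorweinErdelyi1995, §1.2 E.7(b)] -/
theorem prod_Ico_div_eq_inv_choose (n p : ℕ) (hp : p ≤ n) :
    ∏ i ∈ Ico p n, (((n : ℝ) - i) / ((n : ℝ) + i + 1)) = 1 / (Nat.choose (2 * n) (n + p) : ℝ) := by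
  have hsymm : Nat.choose (2 * n) (n + p) = Nat.choose (2 * n) (n - p) := by
    rw [show n - p = 2 * n - (n + p) by omega, Nat.choose_symm (by omega)]
  rw [Finset.prod_div_distrib, prod_Ico_sub_eq_factorial n p hp, prod_Ico_add_eq n p hp, hsymm]
  have hf : ((n - p).factorial : ℝ) ≠ 0 := by exact_mod_cast (Nat.factorial_pos _).ne'
  have hc : (Nat.choose (2 * n) (n - p) : ℝ) ≠ 0 := by
    exact_mod_cast (Nat.choose_pos (by omega)).ne'
  push_cast
  field_simp

/-- **The `L²[0,1]` lower bound, binomial form** [cite: BorweinErdelyi1995, §1.2 E.7(b) last inequality and §4.2 E.2(c)]: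
`∫₀¹ P(u)² du ≥ 1/((2n+1)·binom(2n, n+p)²)` for real monic `P` of degree `n` with `coeff P j = 0` (`j < p ≤ n`) —
i.e. `min ‖xᵖ (x^{n−p} + ⋯)‖²_{L²[0,1]} = (2n+1)^{-1} binom(2n,n+p)^{-2}`, attained, here only the lower bound. -/
theorem integral_sq_ge_inv_choose (n p : ℕ) (hp : p ≤ n) (P : ℝ[X]) (hmon : P.Monic) (hdeg : P.natDegree = n)
    (hlow : ∀ j < p, P.coeff j = 0) :
    1 / ((2 * n + 1) * (Nat.choose (2 * n) (n + p) : ℝ) ^ 2) ≤ ∫ u in (0 : ℝ)..1, (P.eval u) ^ 2 := by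
  have h := integral_sq_ge_prod n p hp P hmon hdeg hlow
  rw [prod_Ico_div_eq_inv_choose n p hp] at h
  have hc : (0 : ℝ) < (Nat.choose (2 * n) (n + p) : ℝ) := by exact_mod_cast Nat.choose_pos (by omega)
  convert h using 1
  field_simp

end MonicSpanL2

end Literature.Algebra.Polynomial

end
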